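import Summits.AtomisticToContinuum.HydrodynamicLimit.Theses.AdiabaticParcels

/-!
# Line `lagrangian_deviation` of the crux `RelativeCoherence` (stmt-AtomisticToContinuum-11909)

Route `route-AtomisticToContinuum-AdiabaticParcels`, crux decl
`Summit.AtomisticToContinuum.HydrodynamicLimit.Theses.AdiabaticParcels.RelativeCoherence`
(RELATIVE LAGRANGIAN COHERENCE: for profiles ∃ σ₀ ∀ σ < σ₀ ∀ classical hs-Euler solutions on `[0,T)`
∀ flows with probability local Gibbs laws whose fields converge at `0`, ∃ C ∀ t < T ∀ r > 0 ∀ η > 0: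
the probability that the tent-weighted (range `r`, INITIAL positions) mean-square difference of LIFTED
displacements `∫₀ᵗ vᵢ − ∫₀ᵗ vⱼ` exceeds `C r² + η` tends to `0`).
Crux-strategist `planner-cstrat-stmt-AtomisticToContinuum-11909-s1-0`, 2026-08-17 (first registered line
of this crux: `ledger crux ls` showed no workfiles, no Disproof.lean, no ideas).

THE LEVER (lens: strengthen/transfer at crux level). The crux is a PAIR statistic with a free constant `C`
uniform in `t < T`. Write the lifted displacement of sphere `i` as
`Dᵢ(t) = Δ(t, xᵢ(0)) + devᵢ(t)`, where `Δ(t,x) = ∫₀ᵗ u(s, X_s x) ds` is the lifted Lagrangian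
displacement of the Euler flow map `X` of the solution's velocity `u` (`Torus.IsFlowMapOn`, the route's own
object) and `devᵢ` the LAGRANGIAN DEVIATION of the sphere from the parcel it started in. On the support of
the tent weight `d(xᵢ(0),xⱼ(0)) < r`, so
`‖Dᵢ − Dⱼ‖² ≤ 3(Lip(Δ_t)² r² + ‖devᵢ‖² + ‖devⱼ‖²)` and the crux's statistic obeys the DETERMINISTIC bound
`S_N(t,r) ≤ 3L²r² + 6 Σᵢ nᵢ‖devᵢ‖² / Σᵢⱼ wᵢⱼ` (`nᵢ = Σⱼ wᵢⱼ`). Hard-core packing at time `0` gives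
`nᵢ ≤ (2r/ε_N + 1)³ ≤ (N+1)(2r/σ+1)³`, and the time-`0` density LLN (hypothesis of the crux) gives
`Σᵢⱼ wᵢⱼ ≥ c(r)(N+1)²` with probability `→ 1`. Hence the crux with `C := 3L²` follows from ONE-BODY
statements: (i) the truncated mean-square Lagrangian deviation `(N+1)⁻¹ Σᵢ min(1,‖devᵢ(t)‖²) → 0` in
probability (LAGRANGIAN TRACKING — sub-macroscopic self-diffusion `≍ N^{-1/6}` in law-of-large-numbers form;
the dynamical heart, stronger in kind than the crux but a one-particle additive functional), (ii) uniform
integrability of the squared lifted displacements at positive times (NO RUNAWAY SPHERES — the crux's mean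
square is UNtruncated, so a vanishing fraction of spheres carrying a macroscopic share of `Σ‖Dᵢ‖²` would break
it; neither Liouville invariance nor the `O(N)` relative entropy of local Gibbs data excludes this, and even
the conjunct does not give it: it is the displacement shadow of `SpeedCapSurgery.GaussianVelocityTails`), and
(iii) the PDE input `sup_{t<T} Lip(Δ_t) < ∞` (LAGRANGIAN DEFORMATION BOUND up to `T`; routine on compact
sub-intervals, a genuine question at a maximal development — the refuter's note (i) of 2026-08-16 on `∃ C`
before `∀ t`).

Nothing here restates the crux or the Statement: `stub_tracking` is false for the ideal gas like the crux but
speaks of one sphere and the Euler flow, not of pairs; `stub_noRunaway` is TRUE for the ideal gas (so cannot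
imply the crux); `stub_reduction` is conditional on both; `stub_flowDeformation` is pure PDE; `stub_flowMap` is
the route's support item `EulerFlowMapExists` (stmt-AtomisticToContinuum-14710) BY NAME.
-/

noncomputable section

open MeasureTheory Filter Set
open scoped ENNReal Topology

namespace Summit.AtomisticToContinuum.HydrodynamicLimit.Cruxes.RelativeCoherence.LagrangianDeviation

open Literature.MathematicalPhysics.KineticTheory
open Summit.AtomisticToContinuum.HydrodynamicLimit.Theses
open Summit.AtomisticToContinuum.HydrodynamicLimit.Theses.AdiabaticParcels

/-! ## §0 Objects of the line -/

/-- The LIFTED DISPLACEMENT of sphere `i` over `[0,t]`, `Dᵢ(t)(z) = ∫₀ᵗ vᵢ(s) ds` — verbatim the interval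
integral of the crux. -/
def disp (σ : ℝ) {N : ℕ}
    (Φ : Literature.Analysis.FluidPDE.HardSphereFlow (Literature.Analysis.FluidPDE.Torus.geometry (Fin 3))
      (hsDiameter σ N) (N + 1))
    (t : ℝ) (z : Literature.Analysis.FluidPDE.Config (N + 1) (Fin 3) T3) (i : Fin (N + 1)) : V3 :=
  ∫ s in (0 : ℝ)..t, (Φ.flow s z i).2

/-- The crux's PAIR STATISTIC `S_N(t,r)(z)`: tent-weighted (range `r`, initial positions, diagonal
included) mean-square difference of lifted displacements — verbatim the quotient in `RelativeCoherence`. -/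
def pairStat (σ : ℝ) {N : ℕ}
    (Φ : Literature.Analysis.FluidPDE.HardSphereFlow (Literature.Analysis.FluidPDE.Torus.geometry (Fin 3))
      (hsDiameter σ N) (N + 1))
    (t r : ℝ) (z : Literature.Analysis.FluidPDE.Config (N + 1) (Fin 3) T3) : ℝ :=
  (∑ i : Fin (N + 1), ∑ j : Fin (N + 1),
      max 0 (1 - Literature.Analysis.FluidPDE.Torus.euclidDist (z i).1 (z j).1 / r) *
        ‖(∫ s in (0 : ℝ)..t, (Φ.flow s z i).2) - ∫ s in (0 : ℝ)..t, (Φ.flow s z j).2‖ ^ 2) /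
    (∑ i : Fin (N + 1), ∑ j : Fin (N + 1),
      max 0 (1 - Literature.Analysis.FluidPDE.Torus.euclidDist (z i).1 (z j).1 / r))

/-- The LIFTED LAGRANGIAN DISPLACEMENT of the Euler flow map: `Δ(t,x) = ∫₀ᵗ u(s, X_s x) ds` (for a flow map
`Xt` of `u` in the sense of `Torus.IsFlowMapOn`, this is `ξ(t) − ξ(0)` for any lift `ξ` of `s ↦ X_s x`). -/
def flowDisp (u : ℝ → T3 → V3) (Xt : ℝ → T3 → T3) (t : ℝ) (x : T3) : V3 :=
  ∫ s in (0 : ℝ)..t, u s (Xt s x)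

/-- The LAGRANGIAN DEVIATION of sphere `i` at time `t`: its lifted displacement minus the lifted displacement
of the Euler parcel it started in, `devᵢ(t) = Dᵢ(t) − Δ(t, xᵢ(0))`. -/
def dev (σ : ℝ) (u : ℝ → T3 → V3) (Xt : ℝ → T3 → T3) {N : ℕ}
    (Φ : Literature.Analysis.FluidPDE.HardSphereFlow (Literature.Analysis.FluidPDE.Torus.geometry (Fin 3))
      (hsDiameter σ N) (N + 1))
    (t : ℝ) (z : Literature.Analysis.FluidPDE.Config (N + 1) (Fin 3) T3) (i : Fin (N + 1)) : V3 :=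
  disp σ Φ t z i - flowDisp u Xt t (z i).1

/-- LAGRANGIAN TRACKING AT TIME `t` (truncated mean square): for every `η > 0`,
`P_N{ η < (N+1)⁻¹ Σᵢ min(1, ‖devᵢ(t)‖²) } → 0`. -/
def TrackingAt (σ : ℝ) (a₀ : T3 → ℝ) (u₀ : T3 → V3) (θ₀ : T3 → ℝ) (u : ℝ → T3 → V3)
    (Xt : ℝ → T3 → T3)
    (Φ : (N : ℕ) → Literature.Analysis.FluidPDE.HardSphereFlow
      (Literature.Analysis.FluidPDE.Torus.geometry (Fin 3)) (hsDiameter σ N) (N + 1))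
    (t : ℝ) : Prop :=
  ∀ η : ℝ, 0 < η →
    Tendsto (fun N => localGibbsLaw σ a₀ u₀ θ₀ N (Φ N)
      {z | η < (∑ i : Fin (N + 1), min 1 (‖dev σ u Xt (Φ N) t z i‖ ^ 2)) / ((N + 1 : ℕ) : ℝ)})
      atTop (𝓝 0)

/-- NO RUNAWAY SPHERES AT TIME `t` (uniform integrability of the squared lifted displacements, uniformly in
`N`): for every `η > 0` there is a level `M` such that, for all large `N`, the probability that the spheres
displaced by more than `M` carry more than `η` of the mean square, `(N+1)⁻¹ Σ_{‖Dᵢ‖>M} ‖Dᵢ(t)‖² > η`, is at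
most `η`. -/
def NoRunawayAt (σ : ℝ) (a₀ : T3 → ℝ) (u₀ : T3 → V3) (θ₀ : T3 → ℝ)
    (Φ : (N : ℕ) → Literature.Analysis.FluidPDE.HardSphereFlow
      (Literature.Analysis.FluidPDE.Torus.geometry (Fin 3)) (hsDiameter σ N) (N + 1))
    (t : ℝ) : Prop :=
  ∀ η : ℝ, 0 < η → ∃ M : ℝ, ∀ᶠ N : ℕ in atTop,
    localGibbsLaw σ a₀ u₀ θ₀ N (Φ N)
      {z | η < (∑ i : Fin (N + 1),
        (if M < ‖disp σ (Φ N) t z i‖ then ‖disp σ (Φ N) t z i‖ ^ 2 else 0)) / ((N + 1 : ℕ) : ℝ)}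
      ≤ ENNReal.ofReal η

/-! ## §1 Stub signatures

`Sig.stub_<name>` is the statement; the registered obligation is `theorem stub_<name> : Sig.stub_<name>`
(§2); `RelativeCoherence_of` takes the five signatures as hypotheses BY NAME. -/

/-- **X — the Lagrangian flow map exists (M).** The route's support item `EulerFlowMapExists`
(stmt-AtomisticToContinuum-14710) by name: a classical hs-Euler solution on `[0,T)` has a flow map
`Torus.IsFlowMapOn (Ico 0 T) u Xt` (global Picard–Lindelöf on the lift). -/
def Sig.stub_flowMap : Prop :=
  AdiabaticParcels.EulerFlowMapExists

/-- **F — Lagrangian deformation bound up to `T` (PDE; M on compact sub-intervals, open at a maximal time).**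
For a classical hs-Euler solution on `[0,T)` and any flow map of its velocity, the lifted Lagrangian
displacement `Δ(t,·) = X_t − id` is Lipschitz for the minimal-image distance with ONE constant for all
`t ∈ [0,T)`. -/
def Sig.stub_flowDeformation : Prop :=
  ∀ (σ T : ℝ) (ρ θ : ℝ → T3 → ℝ) (u : ℝ → T3 → V3), IsHardSphereEulerSolution σ T ρ u θ →
    ∀ Xt : ℝ → T3 → T3, Literature.Analysis.FluidPDE.Torus.IsFlowMapOn (Set.Ico 0 T) u Xt →
      ∃ L : ℝ, 0 ≤ L ∧ ∀ t ∈ Set.Ico 0 T, ∀ x y : T3,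
        ‖flowDisp u Xt t x - flowDisp u Xt t y‖ ≤
          L * Literature.Analysis.FluidPDE.Torus.euclidDist x y

/-- **R — kinematic reduction (L; provable now in principle).** At EVERY `0 < σ < 1` (no smallness): for a
classical solution, a flow map with deformation bound `L` on `[0,T)`, flows with probability local Gibbs
laws whose fields converge at `t = 0`, and a time `t < T` at which Lagrangian tracking and no-runaway hold,
the crux's pair statistic exceeds `3L²r² + η` with probability `→ 0`, for every `r > 0`, `η > 0`. Content:
the three-term inequality on the tent support; hard-core packing `nᵢ ≤ (N+1)(2r/σ+1)³`; the time-`0`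
denominator floor `Σwᵢⱼ ≥ c(r)(N+1)²` w.h.p. from the density LLN (uniformly over the equicontinuous
family of translated tents) and `ρ(0,·) > 0`; truncation removed by no-runaway (`‖devᵢ‖ ≤ ‖Dᵢ‖ + t‖u‖_∞`). -/
def Sig.stub_reduction : Prop :=
  ∀ (σ : ℝ), 0 < σ → σ < 1 →
    ∀ (a₀ θ₀ : T3 → ℝ) (u₀ : T3 → V3) (T : ℝ) (ρ θ : ℝ → T3 → ℝ) (u : ℝ → T3 → V3),
      IsHardSphereEulerSolution σ T ρ u θ →
      ∀ Xt : ℝ → T3 → T3, Literature.Analysis.FluidPDE.Torus.IsFlowMapOn (Set.Ico 0 T) u Xt →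
      ∀ L : ℝ, 0 ≤ L →
        (∀ t ∈ Set.Ico 0 T, ∀ x y : T3,
          ‖flowDisp u Xt t x - flowDisp u Xt t y‖ ≤
            L * Literature.Analysis.FluidPDE.Torus.euclidDist x y) →
        ∀ Φ : (N : ℕ) → Literature.Analysis.FluidPDE.HardSphereFlow
            (Literature.Analysis.FluidPDE.Torus.geometry (Fin 3)) (hsDiameter σ N) (N + 1),
          (∀ N, IsProbabilityMeasure (localGibbsLaw σ a₀ u₀ θ₀ N (Φ N))) →
          TendstoHydroFieldsAt (fun N => localGibbsLaw σ a₀ u₀ θ₀ N (Φ N)) Φ ρ u θ 0 →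
          ∀ t ∈ Set.Ico 0 T,
            TrackingAt σ a₀ u₀ θ₀ u Xt Φ t → NoRunawayAt σ a₀ u₀ θ₀ Φ t →
            ∀ r : ℝ, 0 < r → ∀ η : ℝ, 0 < η →
              Tendsto (fun N => localGibbsLaw σ a₀ u₀ θ₀ N (Φ N)
                {z | 3 * L ^ 2 * r ^ 2 + η < pairStat σ (Φ N) t r z}) atTop (𝓝 0)

/-- **T — Lagrangian tracking (XL; THE HEART).** In the crux's frame (continuous positive profiles,
`σ < σ₀(profiles)`, classical solution on `[0,T)`, any flow map of its velocity, flows, probability local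
Gibbs laws, fields converging at `t = 0`): at every `t < T` the truncated mean-square Lagrangian deviation
`(N+1)⁻¹ Σᵢ min(1,‖devᵢ(t)‖²)` tends to `0` in probability — spheres stay in the Euler parcel they started
in; self-diffusion at fixed reduced density is sub-macroscopic (`≍ N^{-1/6}`). False for the ideal gas and at
Boltzmann–Grad, like the crux. -/
def Sig.stub_tracking : Prop :=
  ∀ (a₀ θ₀ : T3 → ℝ) (u₀ : T3 → V3), Continuous a₀ → Continuous θ₀ → Continuous u₀ →
    (∀ x, 0 < a₀ x) → (∀ x, 0 < θ₀ x) →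
    ∃ σ₀ : ℝ, 0 < σ₀ ∧ ∀ σ : ℝ, 0 < σ → σ < σ₀ →
      ∀ (T : ℝ) (ρ θ : ℝ → T3 → ℝ) (u : ℝ → T3 → V3), IsHardSphereEulerSolution σ T ρ u θ →
        ∀ Xt : ℝ → T3 → T3, Literature.Analysis.FluidPDE.Torus.IsFlowMapOn (Set.Ico 0 T) u Xt →
        ∀ Φ : (N : ℕ) → Literature.Analysis.FluidPDE.HardSphereFlow
            (Literature.Analysis.FluidPDE.Torus.geometry (Fin 3)) (hsDiameter σ N) (N + 1),
          (∀ N, IsProbabilityMeasure (localGibbsLaw σ a₀ u₀ θ₀ N (Φ N))) →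
          TendstoHydroFieldsAt (fun N => localGibbsLaw σ a₀ u₀ θ₀ N (Φ N)) Φ ρ u θ 0 →
          ∀ t ∈ Set.Ico 0 T, TrackingAt σ a₀ u₀ θ₀ u Xt Φ t

/-- **U — no runaway spheres (L–XL).** In the crux's frame: at every `t < T` the squared lifted
displacements are uniformly integrable, uniformly in `N` (`NoRunawayAt`). One-body; the displacement shadow
of uniform Gaussian velocity moments along the flow (`SpeedCapSurgery.GaussianVelocityTails`, stmt-9633 /
4607, implies it); true for the ideal gas. -/
def Sig.stub_noRunaway : Prop :=
  ∀ (a₀ θ₀ : T3 → ℝ) (u₀ : T3 → V3), Continuous a₀ → Continuous θ₀ → Continuous u₀ →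
    (∀ x, 0 < a₀ x) → (∀ x, 0 < θ₀ x) →
    ∃ σ₀ : ℝ, 0 < σ₀ ∧ ∀ σ : ℝ, 0 < σ → σ < σ₀ →
      ∀ (T : ℝ) (ρ θ : ℝ → T3 → ℝ) (u : ℝ → T3 → V3), IsHardSphereEulerSolution σ T ρ u θ →
        ∀ Φ : (N : ℕ) → Literature.Analysis.FluidPDE.HardSphereFlow
            (Literature.Analysis.FluidPDE.Torus.geometry (Fin 3)) (hsDiameter σ N) (N + 1),
          (∀ N, IsProbabilityMeasure (localGibbsLaw σ a₀ u₀ θ₀ N (Φ N))) →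
          TendstoHydroFieldsAt (fun N => localGibbsLaw σ a₀ u₀ θ₀ N (Φ N)) Φ ρ u θ 0 →
          ∀ t ∈ Set.Ico 0 T, NoRunawayAt σ a₀ u₀ θ₀ Φ t

/-! ## §2 Stubs (registered; `sorry` only inside them) — hardest: `stub_tracking` -/

/-- **X (M).** The Lagrangian flow map of a classical hs-Euler solution exists (= `EulerFlowMapExists`). -/
theorem stub_flowMap : Sig.stub_flowMap := by
  sorry

/-- **F (PDE).** One Lipschitz constant for the Lagrangian displacement `X_t − id` on all of `[0,T)`. -/
theorem stub_flowDeformation : Sig.stub_flowDeformation := by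
  sorry

/-- **R (L).** Kinematic reduction: tracking + no-runaway + deformation bound ⇒ coherence with `C = 3L²`. -/
theorem stub_reduction : Sig.stub_reduction := by
  sorry

/-- **T (XL, the heart).** Lagrangian tracking: truncated mean-square deviation from the Euler parcel `→ 0`. -/
theorem stub_tracking : Sig.stub_tracking := by
  sorry

/-- **U (L–XL).** No runaway spheres: uniform integrability of squared lifted displacements at `t > 0`. -/
theorem stub_noRunaway : Sig.stub_noRunaway := by
  sorry

/-! ## §3 Composition (sorry-free) -/

/-- **The line closes the crux modulo its stubs**: `RelativeCoherence` BY NAME from X, F, R, T, U.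
Content: density threshold `min (min σT σU) (1/2)`; the flow map from X, its deformation bound `L` from F;
`C := 3L²`; at each `t < T` tracking (T) and no-runaway (U) are fed to the reduction (R), whose conclusion is
the crux's event verbatim (`pairStat` unfolds to the crux's quotient). -/
theorem RelativeCoherence_of (hX : Sig.stub_flowMap) (hF : Sig.stub_flowDeformation)
    (hR : Sig.stub_reduction) (hT : Sig.stub_tracking) (hU : Sig.stub_noRunaway) :
    AdiabaticParcels.RelativeCoherence := by
  intro a₀ θ₀ u₀ ha hθ hu ha0 hθ0
  obtain ⟨σT, hσT, HT⟩ := hT a₀ θ₀ u₀ ha hθ hu ha0 hθ0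
  obtain ⟨σU, hσU, HU⟩ := hU a₀ θ₀ u₀ ha hθ hu ha0 hθ0
  refine ⟨min (min σT σU) (1 / 2), lt_min (lt_min hσT hσU) (by norm_num), ?_⟩
  intro σ hσ hσlt T ρ θ u hsol Φ hP h0
  have hσT' : σ < σT := lt_of_lt_of_le hσlt ((min_le_left _ _).trans (min_le_left _ _))
  have hσU' : σ < σU := lt_of_lt_of_le hσlt ((min_le_left _ _).trans (min_le_right _ _))
  have hσ1 : σ < 1 := lt_of_lt_of_le hσlt ((min_le_right _ _).trans (by norm_num))
  -- X: the Lagrangian flow map of the solution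
  obtain ⟨Xt, hXt⟩ := hX σ T ρ θ u hsol
  -- F: its deformation bound on [0,T)
  obtain ⟨L, hL0, hL⟩ := hF σ T ρ θ u hsol Xt hXt
  refine ⟨3 * L ^ 2, ?_⟩
  intro t ht r hr η hη
  -- T and U at time t, fed to the reduction R
  have hTr : TrackingAt σ a₀ u₀ θ₀ u Xt Φ t := HT σ hσ hσT' T ρ θ u hsol Xt hXt Φ hP h0 t ht
  have hNr : NoRunawayAt σ a₀ u₀ θ₀ Φ t := HU σ hσ hσU' T ρ θ u hsol Φ hP h0 t ht
  exact hR σ hσ hσ1 a₀ θ₀ u₀ T ρ θ u hsol Xt hXt L hL0 hL Φ hP h0 t ht hTr hNr r hr η hη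

/-- The skeleton instantiated: the crux modulo the five registered stubs. -/
theorem RelativeCoherence_skeleton : AdiabaticParcels.RelativeCoherence :=
  RelativeCoherence_of stub_flowMap stub_flowDeformation stub_reduction stub_tracking stub_noRunaway

end Summit.AtomisticToContinuum.HydrodynamicLimit.Cruxes.RelativeCoherence.LagrangianDeviation

end
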